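import Summits.ABC.IUTFork.Cor312Statement
import HarnessLib

/-!
# [IUTchIII] Cor. 3.12 setting: the `ThetaLinkStrips` binder (and its strip-isomorphism slot) of the Team-A census
# is inhabited at EVERY `Cor312.Setting`

Record-only, proof-only file (D-0012) of the abc-iut cell (WAVE-5 prover abc-iut-w5-d008, L6-lead §F v1.18p
«NV-L6 WAVE» / plan/ADJUDICATION-SPEC §4 (iii) non-vacuity). TAKES NO SIDE on [IUTchIII] Cor. 3.12.

S. Mochizuki, *Inter-universal Teichmüller theory III*, kurims manuscript (May 2020), Def. 3.8 (ii) p. 113 (the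
`𝓕^{⊩▶×μ}`-prime-strips of the Θ^{×μ}_{LGP}-link) and Prop. 3.7 (iii)/(iv) pp. 110–111 (the strips `†𝔉^⊩_LGP`,
`†𝔉^⊩_lgp`, `†𝔉^⊩_gau` and their tautological isomorphisms) [claim: Mochizuki2012, status: disputed].

Every Team-A census theorem of the cone (`Cor312Proof.teamA_chain`, `teamA_statement_end_to_end`,
`…_of_edge/_of_gapGlobal/_of_soundAtInput/_of_globalVolumeTransport`, `Cor312StepXIabcReal.stepXIa_holds`, the
honest census `Cor312TeamAHonestCensus*`) binds a datum `D : ThetaLinkStrips P.LogLink P.Strip` and the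
strip-isomorphism slot `hNE : ∀ n m, Nonempty (P.IsoS (D.stripLGP (P.lattice.logLink n (m−1))) (D.stripDelta
(P.lattice.theater (n+1) m)))` (= (xi-a)'s "the Θ×μ_LGP-link is the full poly-isomorphism", nonempty).  This file
records that BOTH binders are jointly inhabited at every setting `P` of the tree, with no hypothesis, from the
setting's own Prop. 3.7 signature `P.sig`:

* `Cor312.Setting.nonempty_thetaLinkStrips` — `(lg ↦ †𝔉^⊩_LGP, lg ↦ †𝔉^⊩_lgp, ⋆ ↦ †𝔉^⊩_gau)`, i.e.
  `⟨fun _ => P.sig.FLGP, fun _ => P.sig.Flgp, fun _ => P.sig.Fgau⟩`;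
* `Cor312.Setting.exists_thetaLinkStrips_isoS` — a datum TOGETHER WITH the slot `hNE`, using the signature's
  tautological isomorphism `P.sig.isoLGPlgp : P.IsoS †𝔉^⊩_LGP †𝔉^⊩_lgp` (the `△`-slot is filled with `†𝔉^⊩_lgp`).
HONEST LABEL: model-level in the strip VALUES (the genuine strips of the signature), DEGENERATE in the indexing — the
frozen `Cor312.Setting` carries ONE signature, so the witness is constant in the log-link/theater argument; a
theater-indexed family needs theater-indexed signatures (abc-iut-L6-t4 / c312-7, TODO-merge).  Generic interface
facts (`ThetaLinkStrips.nonempty_iff` etc.) are Literature-side, `Literature/IUT/LogThetaLattice/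
ThetaLinkStripsNonVacuity.lean`.  Nothing asserted about print; typed ≠ proved.
-/

namespace Summit.ABC.IUTFork

namespace Cor312.Setting

open Literature.IUT.LogThetaLattice Thm311

variable {T : ThetaIndex} {S : Situation T} (P : Cor312.Setting S)

/-- **The `ThetaLinkStrips` binder of the census is inhabited at every setting**: the constant datum
`(†𝔉^⊩_LGP, †𝔉^⊩_lgp, †𝔉^⊩_gau)` read off `P.sig` ([IUTchIII] Prop. 3.7 (iii)/(iv), Def. 3.8 (ii)).
[cite: Mochizuki2012, III Def 3.8 (ii) p.113] -/
theorem nonempty_thetaLinkStrips : Nonempty (ThetaLinkStrips P.LogLink P.Strip) :=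
  ⟨⟨fun _ => P.sig.FLGP, fun _ => P.sig.Flgp, fun _ => P.sig.Fgau⟩⟩

/-- **The binder `D` AND the strip-isomorphism slot `hNE` of the census are jointly inhabited at every setting**,
by the tautological isomorphism `†𝔉^⊩_LGP ≅ †𝔉^⊩_lgp` of the signature (Prop. 3.7 (iv), p. 111) — the `△`-slot of
the datum being filled with `†𝔉^⊩_lgp` (degenerate indexing, see the module docstring).
[cite: Mochizuki2012, III Prop 3.7 (iv) p.111] -/
theorem exists_thetaLinkStrips_isoS :
    ∃ D : ThetaLinkStrips P.LogLink P.Strip,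
      ∀ n m : ℤ, Nonempty (P.IsoS (D.stripLGP (P.lattice.logLink n (m - 1)))
        (D.stripDelta (P.lattice.theater (n + 1) m))) :=
  ⟨⟨fun _ => P.sig.FLGP, fun _ => P.sig.Flgp, fun _ => P.sig.Flgp⟩, fun _ _ => ⟨P.sig.isoLGPlgp⟩⟩

/-- The same with the `△`-slot filled by `†𝔉^⊩_LGP` itself and the LGP-slot by `†𝔉^⊩_gau`, via the other
tautological isomorphism `†𝔉^⊩_gau ≅ †𝔉^⊩_LGP` of Prop. 3.7 (iii), p. 110 (bookkeeping variant).
[cite: Mochizuki2012, III Prop 3.7 (iii) p.110] -/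
theorem exists_thetaLinkStrips_isoS' :
    ∃ D : ThetaLinkStrips P.LogLink P.Strip,
      ∀ n m : ℤ, Nonempty (P.IsoS (D.stripLGP (P.lattice.logLink n (m - 1)))
        (D.stripDelta (P.lattice.theater (n + 1) m))) :=
  ⟨⟨fun _ => P.sig.Fgau, fun _ => P.sig.Flgp, fun _ => P.sig.FLGP⟩, fun _ _ => ⟨P.sig.isoGauLGP⟩⟩

end Cor312.Setting

end Summit.ABC.IUTFork
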